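import Summits.BirchSwinnertonDyer.BirchSwinnertonDyer.Theorems.RamifiedHeegnerPairLeafCartanKernelZero
import Summits.BirchSwinnertonDyer.BirchSwinnertonDyer.Theorems.RamifiedHeegnerPairLeafCartanKernel
import Summits.BirchSwinnertonDyer.BirchSwinnertonDyer.Theorems.RamifiedHeegnerPairLeafHabitatSocket
import Summits.BirchSwinnertonDyer.BirchSwinnertonDyer.Theorems.ClassRecordThreeEulerHalvesAtThreeResidualUpperBoundCartanPlaceTwistLaw
import Summits.BirchSwinnertonDyer.Rank1Residual.X11b.BDPRouteTamagawaSupport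
import HarnessLib

/-!
# Route `RamifiedHeegnerPair`, crux U₀ `LeafRankZeroUpperAtThree` (stmt-BirchSwinnertonDyer-26024) — KERNEL₀ over the MERGED habitat `HabSC`:
# ROAD₀(`HabSC`) ⟸ leaf Cartan display ∧ FH simple-zero supply with `S ∪ C` inert ∧ (F5′) ∧ print ∧ L₁

HONEST FRAMING. One theorem; helper file (`--supports stmt-BirchSwinnertonDyer-26024 --as helper`); no definition, no named fact, no `sorry`;
CONDITIONAL on every displayed input; nothing about item 26024 is closed; BSD is proved for no curve. Lead prover bsd-line-rhp-p2 g54, 2026-08-30.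

THE POINT. p771318 (`leafCartanRoadZero_of_display_of_supply_of_lowerRankOne`) is ROAD₀ on the `S = ∅` habitat `HabNs`; this file threads an EVEN inert set
`S` of multiplicative primes through the same argument, exactly as the U₁ line `offhabitat` (crux-ideate seat 1 g5) did for rank one: the landed rank-zero
budget-set core `leafRankZeroUpper_three_of_shimuraInertDatum_at_saving_of_budgetSet` (p771117) already takes `S`, `q₁`, `C` at once. With the
UNCONDITIONAL (IMAGE) p774386 and (ATLAS) p774819 (rank-free) this is the road of a U₀ row cut `offhabitat0` whose research residue is Σ★⁸₀ on the two
atlas regions only. [cite: KohenPacetti2016, Thm. 3.6, Thm. 3.7] [cite: FriedbergHoffstein1995, Thm. B] [cite: JetchevSkinnerWan2017, §7.4.2 (c)]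
[cite: BumpFriedbergHoffstein1990, Theorem (Introduction, pp. 543–544)] [cite: Miller2011LMS, Def. 1.1]
-/

set_option linter.dupNamespace false
set_option autoImplicit false

noncomputable section

open scoped Classical NumberField

open WeierstrassCurve NumberField IsDedekindDomain Literature Literature.NumberTheory.EllipticCurves
  Rat.HeightOneSpectrum CongruenceSubgroup
  Literature.NumberTheory.EllipticCurves.ModularForms
  Literature.NumberTheory.EllipticCurves.Rank1Residual
  Literature.NumberTheory.EllipticCurves.Rank1Residual.Typed
  Literature.NumberTheory.QuadraticFields.Quadratic
  Literature.NumberTheory.Automorphic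
  Summit.BirchSwinnertonDyer.Rank1Residual
  Summit.BirchSwinnertonDyer.Rank1Residual.Additive
  Summit.BirchSwinnertonDyer.Rank1Residual.X11b
  Summit.BirchSwinnertonDyer.Rank1Residual.X11b.Three
  Summit.BirchSwinnertonDyer.BirchSwinnertonDyer.Theses.RamifiedHeegnerPair
  Summit.BirchSwinnertonDyer.BirchSwinnertonDyer.Theorems

namespace Summit.BirchSwinnertonDyer.BirchSwinnertonDyer.Theorems.LeafCartanKernelZero

/-- **KERNEL₀(`HabSC`)** — `Typed.MissingUpperBoundAt W 3` on a `HabSC` row (ρ̄₃ onto; an EVEN inert set `S` of multiplicative primes; a Cartan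
set `C`; one exempted bad prime `q₁`; SHAPE, the très-ramifié clause and the (DEG) disjunction) of a non-CM Gss2 leaf curve of analytic rank ZERO with a
lattice-optimal datum (`3 ∤ c`), from the print (GZK, entireness, modularity, JL, Pasten §6 CO), the twist supply WITH A SIMPLE ZERO and `S ∪ C` inert
(Friedberg–Hoffstein Thm. B special case, INLINE; = `friedbergHoffstein_exists_twist_simpleZero_inertAt_sq_splitTwo`, p773715 pending), the leaf Cartan
SAVED display (INLINE, rank-free), (F5′) `CartanPlaceTwistLaw.cartanPlaceTwistLawAtThree` and L₁ at the rank-ONE leaf partner. PROOF = the U₁ kernel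
`Offhabitat.missingUpperBoundAt_three_of_habSCData` (crux-ideate seat 1 g5) transposed to rank zero over the landed rank-zero budget-set core p771117
(`leafRankZeroUpper_three_of_shimuraInertDatum_at_saving_of_budgetSet`, which already takes `S`, `q₁`, `C`); p771318 is its `S = ∅` slice.
CONDITIONAL on every displayed input; nothing about BSD is proved.
-- adapted from Summits/BirchSwinnertonDyer/BirchSwinnertonDyer/Cruxes/LeafRankOneUpperAtThree/Lines/offhabitat.lean (rank 1 ↦ rank 0)
[cite: KohenPacetti2016, Thm. 3.6, Thm. 3.7] [cite: FriedbergHoffstein1995, Thm. B] [cite: Jetchev2008, Thm. 1.1 (p. 812)] [cite: Miller2011LMS, Def. 1.1] -/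
theorem leafCartanRoadZeroSC_of_display_of_supply_of_lowerRankOne
    (hGZK : rank_eq_analyticRank_of_analyticRank_le_one) (hmod : hasEntireLFunction_rat)
    (hnf : exists_isNewformOf) (hJL : nonempty_shimuraParametrizationData)
    (hCO : PastenShimura2024_componentOrders)
    (hFH : ∀ (W : WeierstrassCurve ℚ) [W.IsElliptic], W.rootNumber = 1 →
      ∀ (S C : Finset ℕ), (∀ ℓ ∈ S, ∃ _ : Fact ℓ.Prime, W.HasMultiplicativeReductionAtPrime ℓ) →
        Even S.card →
        (∀ q ∈ C, ∃ _ : Fact q.Prime, q ^ 2 ∣ W.conductorNorm ℤ ∧ ¬ q ^ 3 ∣ W.conductorNorm ℤ) →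
      ∀ B : ℕ, ∃ (K : Type) (_ : Field K) (_ : NumberField K),
        IsImaginaryQuadratic K ∧ B < (NumberField.discr K).natAbs ∧
          (∀ ℓ ∈ S ∪ C, ((Ideal.span {(ℓ : ℤ)}).primesOver (𝓞 K)).ncard = 1 ∧
            ¬ (ℓ : ℤ) ∣ NumberField.discr K) ∧
          (∀ ℓ : ℕ, ℓ.Prime → ℓ ∣ W.conductorNorm ℤ → ℓ ∉ S → ℓ ∉ C →
            ((Ideal.span {(ℓ : ℤ)}).primesOver (𝓞 K)).ncard = 2) ∧
          (¬ 2 ∣ W.conductorNorm ℤ → ((Ideal.span {(2 : ℤ)}).primesOver (𝓞 K)).ncard = 2) ∧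
          (W.quadraticTwist (NumberField.discr K : ℚ)).entireLFunction 1 = 0 ∧
          deriv (W.quadraticTwist (NumberField.discr K : ℚ)).entireLFunction 1 ≠ 0)
    (hDisp : ∀ (V : WeierstrassCurve ℚ) [V.IsElliptic] [V.IsGloballyMinimal], ¬ V.HasCM → Addv V 3 → SubGss V 3 → Surj V 3 →
      ∀ (N : ℕ) [NeZero N] (K : Type) [Field K] [NumberField K] (S C : Finset ℕ)
      (Dt : ModularParametrizationData V N)
      (X : ShimuraCurveData (∏ q ∈ S, q) (N / ∏ q ∈ S, q))
      (W' : WeierstrassCurve ℚ) [W'.IsElliptic] (P₀ : ShimuraParametrizationData X W'),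
      V.conductorNorm ℤ = N → IsImaginaryQuadratic K → NumberField.discr K < -4 → Even S.card →
      (∀ ℓ ∈ S, ℓ.Prime ∧ ℓ ∣ N ∧ ¬ ℓ ^ 2 ∣ N ∧
        ((Ideal.span {(ℓ : ℤ)}).primesOver (𝓞 K)).ncard = 1 ∧ ¬ (ℓ : ℤ) ∣ NumberField.discr K) →
      (∀ q ∈ C, ∃ _ : Fact q.Prime, q ≠ 3 ∧ q ^ 2 ∣ N ∧ ¬ q ^ 3 ∣ N ∧
        3 ∣ (V.baseChange ℚ_[q]).localTamagawaNumber ℤ_[q] ∧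
        ((Ideal.span {(q : ℤ)}).primesOver (𝓞 K)).ncard = 1 ∧ ¬ (q : ℤ) ∣ NumberField.discr K) →
      (∀ ℓ : ℕ, ℓ.Prime → ℓ ∣ N → ℓ ∉ S → ℓ ∉ C → ((Ideal.span {(ℓ : ℤ)}).primesOver (𝓞 K)).ncard = 2) →
      ¬ (3 : ℤ) ∣ Dt.c → P₀.IsMinimalFor V →
      ∃ (P : (V.baseChange K).toAffine.Point) (degC : ℕ), 0 < degC ∧
        padicValNat 3 degC + C.card = padicValNat 3 P₀.deg ∧
        LDerivEK V K =
          8 * (Real.pi : ℂ) ^ 2 * peterssonProduct (Gamma0 N) 2 Dt.f Dt.f /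
              ((((Units.torsionOrder K : ℝ) / 2) ^ 2 * √|(NumberField.discr K : ℝ)| : ℝ) : ℂ) *
            ((P.canonicalHeight : ℂ) / (degC : ℂ)) ∧
        (¬ IsOfFinAddOrder P → ∀ (q : ℕ) [Fact q.Prime] (s : ℕ), q ∉ S → q ∉ C →
          s ≤ padicValNat 3 ((V.baseChange ℚ_[q]).localTamagawaNumber ℤ_[q]) →
          padicValNat 3 (Nat.card (AddCommGroup.primaryComponent (V.baseChange K).sha 3)) + 2 * s ≤
            2 * padicValNat 3 (AddSubgroup.zmultiples P).index))
    (hL1 : Gss2LowerAtThreeRankOne)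
    (W : WeierstrassCurve ℚ) [W.IsElliptic] [W.IsGloballyMinimal] (N : ℕ) [NeZero N]
    (Dt : ModularParametrizationData W N)
    (hCM : ¬ W.HasCM) (hadd : Addv W 3) (hsub : SubGss W 3) (hr : W.analyticRank = 0) (hN : W.conductorNorm ℤ = N)
    (hc : ¬ (3 : ℤ) ∣ Dt.c) (hsurj : Surj W 3)
    (S C : Finset ℕ) (q₁ : ℕ) [Fact q₁.Prime] (hSeven : Even S.card)
    (hbad₁ : ¬ W.HasGoodReductionAtPrime q₁) (hq₁S : q₁ ∉ S) (hq₁C : q₁ ∉ C)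
    (hSmult : ∀ ℓ ∈ S, ∃ _ : Fact ℓ.Prime, W.HasMultiplicativeReductionAtPrime ℓ)
    (hCdata : ∀ q ∈ C, ∃ _ : Fact q.Prime, q ≠ 3 ∧ q ^ 2 ∣ W.conductorNorm ℤ ∧ ¬ q ^ 3 ∣ W.conductorNorm ℤ ∧
      3 ∣ (W.baseChange ℚ_[q]).localTamagawaNumber ℤ_[q])
    (hshape : ∀ (q : ℕ) [Fact q.Prime], q ≠ q₁ → q ∉ C → 3 ∣ (W.baseChange ℚ_[q]).localTamagawaNumber ℤ_[q] →
      W.HasSplitMultiplicativeReductionAtPrime q)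
    (hFC : ∀ (ℓ : ℕ) [Fact ℓ.Prime], ℓ ∉ S → ℓ ≠ q₁ → ℓ ∉ C → W.HasSplitMultiplicativeReductionAtPrime ℓ →
      ¬ 3 ∣ padicValInt ℓ W.minimalDiscriminantInt)
    (hDEG : (∃ ℓ₀ ∈ S, ¬ 3 ∣ padicValInt ℓ₀ W.minimalDiscriminantInt) ∨
      (∃ ℓ₀ t : ℕ, ∃ _ : Fact ℓ₀.Prime, ∃ _ : Fact t.Prime,
        W.HasMultiplicativeReductionAtPrime ℓ₀ ∧ W.HasMultiplicativeReductionAtPrime t ∧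
        ℓ₀ ∉ S ∧ t ∉ S ∧ t ≠ ℓ₀ ∧ ¬ 3 ∣ padicValInt ℓ₀ W.minimalDiscriminantInt) ∨
      (∃ R : Finset ℕ, R ⊆ S ∧ 2 * R.card = S.card ∧ ∀ q ∈ R, q = 2 ∨ ¬ 3 ∣ q - 1)) :
    MissingUpperBoundAt W 3 := by
  subst hN
  haveI h3F : Fact (Nat.Prime 3) := ⟨Nat.prime_three⟩
  have hp : (3 : ℕ).Prime := Nat.prime_three
  have hbad3 : ¬ W.HasGoodReductionAtPrime 3 := not_good_of_addv W 3 hadd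
  have h3C : (3 : ℕ) ∉ C := by
    intro h
    obtain ⟨_, h33, -⟩ := hCdata 3 h
    exact h33 rfl
  have h3S : (3 : ℕ) ∉ S := by
    intro h
    obtain ⟨_, hm⟩ := hSmult 3 h
    exact not_mult_of_addv W 3 hadd hm
  have hCsq : ∀ q ∈ C, ∃ _ : Fact q.Prime, q ^ 2 ∣ W.conductorNorm ℤ ∧ ¬ q ^ 3 ∣ W.conductorNorm ℤ := by
    intro q hq
    obtain ⟨hqF, -, h2, h3, -⟩ := hCdata q hq
    exact ⟨hqF, h2, h3⟩
  -- (F5′) at the Cartan places: the local budget over the pair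
  have hbudget : ∀ (K : Type) [Field K] [NumberField K], IsImaginaryQuadratic K →
      (∀ q ∈ C, ((Ideal.span {(q : ℤ)}).primesOver (𝓞 K)).ncard = 1 ∧ ¬ (q : ℤ) ∣ NumberField.discr K) →
      ∀ (Cd : VariableChange ℚ) (Wd : WeierstrassCurve ℚ) [Wd.IsElliptic] [Wd.IsGloballyMinimal],
        Cd • W.quadraticTwist (NumberField.discr K : ℚ) = Wd →
        ∀ (q : ℕ) [Fact q.Prime], q ∈ C →
          padicValNat 3 ((W.baseChange ℚ_[q]).localTamagawaNumber ℤ_[q]) +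
            padicValNat 3 ((Wd.baseChange ℚ_[q]).localTamagawaNumber ℤ_[q]) ≤ 1 := by
    intro K _ _ hK hCin Cd Wd _ _ hWd q hqF hq
    obtain ⟨_, hq3, h2, h3, hcq⟩ := hCdata q hq
    obtain ⟨hn, hd⟩ := hCin q hq
    exact (CartanPlaceTwistLaw.cartanPlaceTwistLawAtThree W q hq3 h2 h3 hcq K hK hn hd Cd Wd hWd).1
  -- the field: `S ∪ C` inert-unramified, every other bad prime split, `2` split if `2 ∤ N`, `|d_K| > 4`, `L(W^{(d_K)},s)` with a SIMPLE zero at `1`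
  have hw : W.rootNumber = 1 := by
    rw [WeierstrassCurve.rootNumber_eq_neg_one_pow_analyticRank_of_exists_isNewformOf hnf W, hr]
    norm_num
  obtain ⟨K, _, _, hK, hB, hinSC, hsplitN, h2, hLt0, hLt1⟩ := hFH W hw S C hSmult hSeven hCsq 4
  have hinert : ∀ ℓ ∈ S, ((Ideal.span {(ℓ : ℤ)}).primesOver (𝓞 K)).ncard = 1 ∧ ¬ (ℓ : ℤ) ∣ NumberField.discr K :=
    fun ℓ hℓ ↦ hinSC ℓ (Finset.mem_union_left C hℓ)
  have hinertC : ∀ q ∈ C, ((Ideal.span {(q : ℤ)}).primesOver (𝓞 K)).ncard = 1 ∧ ¬ (q : ℤ) ∣ NumberField.discr K :=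
    fun q hq ↦ hinSC q (Finset.mem_union_right S hq)
  -- `d_K` is odd: `2` is inert-unramified (in `S` or `C`), a bad prime off `S ∪ C` (split), or split by the clause
  have hodd : Odd (NumberField.discr K) := by
    refine LeafShimuraInert.odd_discr_of_two_inert_or_split hK.1 ?_
    by_cases h2S : 2 ∈ S
    · left
      obtain ⟨hn, hd⟩ := hinert 2 h2S
      exact ⟨by exact_mod_cast hn, by exact_mod_cast hd⟩
    by_cases h2C : 2 ∈ C
    · left
      obtain ⟨hn, hd⟩ := hinertC 2 h2C
      exact ⟨by exact_mod_cast hn, by exact_mod_cast hd⟩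
    · right
      by_cases h2N : 2 ∣ W.conductorNorm ℤ
      · exact_mod_cast hsplitN 2 Nat.prime_two h2N h2S h2C
      · exact h2 h2N
  -- `d_K < -4`
  have hD : NumberField.discr K < -4 := by
    haveI : IsTotallyComplex K := hK.2
    have hneg : NumberField.discr K < 0 := discr_neg_of_finrank_eq_two K hK.1
    have hB' : 4 < (NumberField.discr K).natAbs := hB
    omega
  -- `3` splits (bad, off `S ∪ C`), so the minimal twist is a rank-ONE LEAF curve: L₁ pays its lower half
  have h3N : 3 ∣ W.conductorNorm ℤ := (W.dvd_conductorNorm_iff_not_hasGoodReductionAtPrime 3).mpr hbad3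
  have hH3 : SatisfiesHeegnerHypothesis 3 K := fun q hq hq3 ↦ by
    have : q = 3 := (Nat.prime_dvd_prime_iff_eq hq hp).mp hq3
    subst this
    exact hsplitN 3 hp h3N h3S h3C
  have hD0 : (NumberField.discr K : ℚ) ≠ 0 := by exact_mod_cast NumberField.discr_ne_zero K
  haveI hEt : (W.quadraticTwist (NumberField.discr K : ℚ)).IsElliptic := W.isElliptic_quadraticTwist hD0
  have hPL : ∀ (Wd : WeierstrassCurve ℚ) [Wd.IsElliptic] [Wd.IsGloballyMinimal] (Cd : VariableChange ℚ),
      Cd • W.quadraticTwist (NumberField.discr K : ℚ) = Wd → MissingLowerBoundAt Wd 3 := by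
    intro Wd _ _ Cd hWd
    obtain ⟨hCMd, haddd, hsubd, -⟩ := LeafShimuraInert.leaf_twist_of_split_three W hCM hadd hsub K hK hH3 hodd Wd Cd hWd
    have hrd : Wd.analyticRank = 1 := by
      rw [← hWd, analyticRank_smul]
      exact analyticRank_eq_one_of_entireLFunction_one_eq_zero_of_deriv_ne_zero _ (hmod _) hLt0 hLt1
    exact hL1 Wd hCMd haddd hsubd hrd
  -- local data of the inert set `S`: primes dividing `N` exactly once, inert and unramified in `K`
  have hSin : ∀ ℓ ∈ S, ℓ.Prime ∧ ℓ ∣ W.conductorNorm ℤ ∧ ¬ ℓ ^ 2 ∣ W.conductorNorm ℤ ∧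
      ((Ideal.span {(ℓ : ℤ)}).primesOver (𝓞 K)).ncard = 1 ∧ ¬ (ℓ : ℤ) ∣ NumberField.discr K := by
    intro ℓ hℓ
    obtain ⟨hℓF, hm⟩ := hSmult ℓ hℓ
    obtain ⟨hn, hd⟩ := hinert ℓ hℓ
    have hℓN : ℓ ∣ W.conductorNorm ℤ :=
      (W.dvd_conductorNorm_iff_not_hasGoodReductionAtPrime ℓ).mpr
        (WeierstrassCurve.HasMultiplicativeReduction.not_hasGoodReduction (R := ℤ_[ℓ]) hm)
    exact ⟨hℓF.out, hℓN, X11b.not_sq_dvd_conductorNorm_of_mult W ℓ hm, hn, hd⟩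
  -- the display at `(K, S, C)`
  have hCin : ∀ q ∈ C, ∃ _ : Fact q.Prime, q ≠ 3 ∧ q ^ 2 ∣ W.conductorNorm ℤ ∧ ¬ q ^ 3 ∣ W.conductorNorm ℤ ∧
      3 ∣ (W.baseChange ℚ_[q]).localTamagawaNumber ℤ_[q] ∧
      ((Ideal.span {(q : ℤ)}).primesOver (𝓞 K)).ncard = 1 ∧ ¬ (q : ℤ) ∣ NumberField.discr K := by
    intro q hq
    obtain ⟨hqF, hq3, h2', h3', hcq⟩ := hCdata q hq
    obtain ⟨hn, hd⟩ := hinertC q hq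
    exact ⟨hqF, hq3, h2', h3', hcq, hn, hd⟩
  have hHKat : ∀ (X : ShimuraCurveData (∏ q ∈ S, q) (W.conductorNorm ℤ / ∏ q ∈ S, q))
      (W' : WeierstrassCurve ℚ) [W'.IsElliptic] (P₀ : ShimuraParametrizationData X W'), P₀.IsMinimalFor W →
      ∃ (P : (W.baseChange K).toAffine.Point) (degS : ℕ), 0 < degS ∧
        padicValNat 3 degS + C.card = padicValNat 3 P₀.deg ∧
        LDerivEK W K =
          8 * (Real.pi : ℂ) ^ 2 * peterssonProduct (Gamma0 (W.conductorNorm ℤ)) 2 Dt.f Dt.f /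
              ((((Units.torsionOrder K : ℝ) / 2) ^ 2 * √|(NumberField.discr K : ℝ)| : ℝ) : ℂ) *
            ((P.canonicalHeight : ℂ) / (degS : ℂ)) ∧
        (¬ IsOfFinAddOrder P → ∀ (q : ℕ) [Fact q.Prime] (s : ℕ), q ∉ S → q ∉ C →
          s ≤ padicValNat 3 ((W.baseChange ℚ_[q]).localTamagawaNumber ℤ_[q]) →
          padicValNat 3 (Nat.card (AddCommGroup.primaryComponent (W.baseChange K).sha 3)) + 2 * s ≤
            2 * padicValNat 3 (AddSubgroup.zmultiples P).index) :=
    fun X W' _ P₀ hP₀ ↦ hDisp W hCM hadd hsub hsurj (W.conductorNorm ℤ) K S C Dt X W' P₀ rfl hK hD hSeven hSin hCin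
      hsplitN hc hP₀
  -- the leaf budget-set core at `(S, q₁, C)`
  exact leafRankZeroUpper_three_of_shimuraInertDatum_at_saving_of_budgetSet hGZK hmod hnf hJL hCO W hadd hsub
    hr rfl Dt hc S hSeven hSmult q₁ hbad₁ hq₁S C hq₁C hCdata hbudget hFC hshape hDEG K hK hodd hinert hinertC hsplitN hLt0 hLt1 hHKat hPL

end Summit.BirchSwinnertonDyer.BirchSwinnertonDyer.Theorems.LeafCartanKernelZero

end
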